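import Summits.ResolutionOfSingularities.ResolutionOfSingularities.Theorems.EquisingularLiftEquisingularLiftNatClusterLiftWitness
import Summits.ResolutionOfSingularities.ResolutionOfSingularities.Theorems.EquisingularLiftEquisingularLiftNatDeltaConeLiftCentred
import Mathlib
import HarnessLib

/-!
# [OURS · L1 W4.5(b)] T-CLUSTER-LIFT part 9 — PACKAGE (vi) AT A GENERAL POINT: the strict-transform charts of the blow-up of a
# section `a` in general position (translate `X ↦ X + a`, then `X_p ↦ X_p, X_l ↦ X_p·X_l`), as `O`-linear chart maps on the centred
# forms, and the Δ-regular cluster-centred cone WITH these charts (crux `EquisingularLiftNat` = stmt-ResolutionOfSingularities-20038; v7′)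

NOT a statement of any manuscript. Helper file of the chain res-L1-w45b (cell `res-hironaka`, LADDER-RESOLUTION rung L, slot
W4.5(b)); OURS; AI-written, weaker than expert review; `--supports stmt-ResolutionOfSingularities-20038 --as helper` by
res-L1-w45b-stub-3 (object T-CLUSTER-LIFT part 9 = the last item of offer (A): package (vi) of res-L1-w45b-stub-1's HSUB′
architecture at a point in GENERAL position). No `sorry`; standard axioms.

WHAT. For the TC⁺⁺ member cone `Φ` (parts 7–8) the supplier must know, at EVERY sectioned point `a_t` (chart `i_t`), that the strict
transforms of `V(Φ(T_{i_t} := 1))` on the two charts of the blow-up of the section are Δ-regular (package (vi); res-L1-w45b-stub-1's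
T-ΔLIFT-CENTRED p523916 does it at the vertex `[1:0:0]` with the substitutions `T ↦ (1, X, XY)`, `(1, XY, Y)`). At a general point the
chart of the blow-up dominated by the coordinate `p ≠ i_t` is the composite `B_{a,p} := β_p ∘ sh_a` of the TRANSLATION
`sh_a : X ↦ X + a` (part 1) and res-L1-w45b-stub-4's blow-up substitution `β_p : X_p ↦ X_p, X_l ↦ X_p X_l` (p525038, written inline);
for `f ∈ 𝔪_a^m` one has `B_{a,p} f = X_p^m · st_{a,p,m}(f)` with the STRICT-TRANSFORM CHART `st_{a,p,m}(f) := (B_{a,p} f) /ᵐᵒⁿ X_p^m`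
(Mathlib `MvPolynomial.divMonomial`), which is `O`-LINEAR in `f` and commutes with `map π` — so part 8's
`exists_isHomogeneous_clusterLift_deltaRegular_off_linear` applies with these extra chart maps:

* `aeval_blowupSubst_mem_span_X_pow` (`f ∈ (X)^m ⇒ β_p f ∈ (X_p^m)`), `blowupSubst_shift_mem_span_X_pow` (`f ∈ 𝔪_a^m ⇒ B_{a,p} f ∈ (X_p^m)`),
  `X_pow_mul_divMonomial_eq_of_mem` (`X_p^m · ((B f) /ᵐᵒⁿ X_p^m) = B f` then), `map_divMonomial`, `map_blowupSubst_shift` (reduction);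
* **`exists_isHomogeneous_clusterLift_deltaRegular_stCharts`** — THE CONE WITH PACKAGE (vi): part 7's data (cluster `(i, a, m)` with
  `hind`, `g`, standard-chart excluded sets `E j` and bad-prime finiteness, witness `M̄` through the cluster avoiding the bad primes off `E`)
  PLUS, for every sectioned point `t` and blow-up chart `p ≠ i_t`: the downstairs strict transform `gst t p` (`X_p^{m t} · gst = B_{ā_t,p}(g(T_{i_t} := 1))`)
  with finitely many bad primes, an excluded set `E' t p`, and the witness's strict transform `Mst t p` avoiding the bad primes of `gst t p`
  off `E' t p` ⇒ a form `Φ ∈ O[T_σ]_d`, `π Φ = g`, CENTRED at every section, Δ-regular off `E j` on every standard chart, AND with strict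
  transforms `Φst t p` (`X_p^{m t} · Φst = B_{a_t,p}(Φ(T_{i_t} := 1))`, `π Φst = gst t p`) Δ-regular off `E' t p` — ONE genericity constant
  for all charts.

References: parts 1–8; res-L1-w45b-stub-1 …NatDeltaConeLiftCentred p523916 (`map_aeval_of_map_comp`, vertex pattern); res-L1-w45b-stub-4
…NatBlowupSubstSquarefree p525038 (the substitution `β_p`); Mathlib `MvPolynomial.divMonomial`. res-L1-w45b-lead-2 LEAD-MEMO-5/6,
res-L1-w45b-stub-1 HSUB′ skeleton (OURS planning texts, index only).
-/

set_option linter.dupNamespace false -- mandated namespace `Summit.<Summit>.<Problem>` of this single-conjunct summit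
set_option linter.overlappingInstances false -- [IsDomain O] and [IsDiscreteValuationRing O] as in …NatDeltaConeLift

noncomputable section

open MvPolynomial IsLocalRing Literature.AlgebraicGeometry.Resolution
open Summit.ResolutionOfSingularities.ResolutionOfSingularities.Theorems
open Summit.ResolutionOfSingularities.ResolutionOfSingularities.Theorems.EquisingularLiftNat.ClusterLift

namespace Summit.ResolutionOfSingularities.ResolutionOfSingularities.Cruxes.EquisingularLiftNat.Sections

universe u

/-! ## The blow-up chart at a general point: `B_{a,p} = β_p ∘ sh_a` and the strict-transform chart `(B f) /ᵐᵒⁿ X_p^m` -/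

section Chart

variable {R : Type*} [CommRing R] {τ : Type*} [DecidableEq τ] (p : τ) (a : τ → R)

/-- `β_p` maps the `m`-th power of the ideal of the origin into `(X_p^m)`: every variable goes to a multiple of `X_p`. [folklore] -/
theorem aeval_blowupSubst_mem_span_X_pow {m : ℕ} {f : MvPolynomial τ R} (hf : f ∈ idealOfVars τ R ^ m) :
    aeval (fun j => if j = p then (X p : MvPolynomial τ R) else X p * X j) f ∈ Ideal.span {(X p : MvPolynomial τ R) ^ m} := by
  have hle : Ideal.map (aeval fun j => if j = p then (X p : MvPolynomial τ R) else X p * X j) (idealOfVars τ R) ≤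
      Ideal.span {(X p : MvPolynomial τ R)} := by
    rw [idealOfVars, Ideal.map_span, Ideal.span_le]
    rintro _ ⟨_, ⟨j, rfl⟩, rfl⟩
    rw [SetLike.mem_coe, aeval_X]
    split_ifs
    · exact Ideal.mem_span_singleton_self _
    · exact Ideal.mul_mem_right _ _ (Ideal.mem_span_singleton_self _)
  have h := Ideal.mem_map_of_mem (aeval fun j => if j = p then (X p : MvPolynomial τ R) else X p * X j) hf
  rw [Ideal.map_pow] at h
  rw [← Ideal.span_singleton_pow]
  exact Ideal.pow_right_mono hle m h

/-- `f ∈ 𝔪_a^m ⇒ B_{a,p} f = β_p (f(X + a)) ∈ (X_p^m)`. [folklore] -/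
theorem blowupSubst_shift_mem_span_X_pow {m : ℕ} {f : MvPolynomial τ R}
    (hf : f ∈ (Ideal.span (Set.range fun l : τ => (X l : MvPolynomial τ R) - C (a l))) ^ m) :
    aeval (fun j => if j = p then (X p : MvPolynomial τ R) else X p * X j)
      (aeval (fun l : τ => (X l : MvPolynomial τ R) + C (a l)) f) ∈ Ideal.span {(X p : MvPolynomial τ R) ^ m} := by
  refine aeval_blowupSubst_mem_span_X_pow p ?_
  have h := Ideal.mem_map_of_mem (aeval fun l : τ => (X l : MvPolynomial τ R) + C (a l)) hf
  rwa [Ideal.map_pow, map_aeval_span_X_sub_C] at h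

omit [DecidableEq τ] in
/-- If `F ∈ (X_p^m)` then `X_p^m · (F /ᵐᵒⁿ X_p^m) = F`. [folklore] -/
theorem X_pow_mul_divMonomial_eq_of_mem {m : ℕ} {F : MvPolynomial τ R} (hF : F ∈ Ideal.span {(X p : MvPolynomial τ R) ^ m}) :
    X p ^ m * F.divMonomial (Finsupp.single p m) = F := by
  obtain ⟨G, rfl⟩ := Ideal.mem_span_singleton'.mp hF
  rw [mul_comm G, X_pow_eq_monomial, divMonomial_monomial_mul]

omit [DecidableEq τ] in
/-- `divMonomial` commutes with change of coefficients. [folklore] -/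
theorem map_divMonomial {S : Type*} [CommRing S] (f : R →+* S) (F : MvPolynomial τ R) (s : τ →₀ ℕ) :
    MvPolynomial.map f (F.divMonomial s) = (MvPolynomial.map f F).divMonomial s := by
  ext β
  rw [coeff_map, coeff_divMonomial, coeff_divMonomial, coeff_map]

omit [DecidableEq τ] in
/-- `divMonomial` is linear: scalars. [folklore] -/
theorem smul_divMonomial (c : R) (F : MvPolynomial τ R) (s : τ →₀ ℕ) :
    (c • F).divMonomial s = c • F.divMonomial s := by
  ext β
  rw [coeff_divMonomial, coeff_smul, coeff_smul, coeff_divMonomial]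

/-- Reduction commutes with `B_{a,p}`: `map f (β_p (F(X + a))) = β_p ((map f F)(X + f a))`. [folklore] -/
theorem map_blowupSubst_shift {S : Type*} [CommRing S] (f : R →+* S) (F : MvPolynomial τ R) :
    MvPolynomial.map f (aeval (fun j => if j = p then (X p : MvPolynomial τ R) else X p * X j)
      (aeval (fun l : τ => (X l : MvPolynomial τ R) + C (a l)) F)) =
    aeval (fun j => if j = p then (X p : MvPolynomial τ S) else X p * X j)
      (aeval (fun l : τ => (X l : MvPolynomial τ S) + C (f (a l))) (MvPolynomial.map f F)) := by
  rw [map_aeval_of_map_comp f _ (fun j => if j = p then (X p : MvPolynomial τ S) else X p * X j)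
    (fun j => by split_ifs <;> simp), map_aeval_X_add_C]

end Chart

/-! ## The Δ-regular cluster-centred cone with the strict-transform charts (package (vi)) -/

section Cone

variable {O : Type u} [CommRing O] [IsDomain O] [IsDiscreteValuationRing O] {ϖ : O}
variable {k : Type u} [Field k] [Infinite k]
variable {σ : Type u} [Finite σ] [DecidableEq σ] {ι : Type u} [Finite ι]

/-- **THE Δ-REGULAR CLUSTER-CENTRED CONE WITH PACKAGE (vi).** `O` a DVR, `ϖ` irreducible, `π : O ↠ k` onto an infinite field, `ker π = (ϖ)`.
Cluster `(i, a, m)` with the independence clause `hind` at the reduced cluster; `g ∈ k[T_σ]_d` of order `≥ m t` at each `ā_t`. Standard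
charts: excluded sets `E j`, finitely many bad primes of `g(T_j := 1)`. Strict-transform charts: for each sectioned point `t` and each
coordinate `p ≠ i t`, the downstairs strict transform `gst t p` of `g(T_{i t} := 1)` on the `p`-chart of the blow-up of `ā_t`
(`X_p^{m t} · gst t p = β_p(g(T_{i t} := 1)(X + ā_t))`), with finitely many bad primes and an excluded set `E' t p`. Witness: `M̄ ∈ k[T_σ]_d`
through the cluster whose dehomogenisations avoid the bad primes of `g` off `E` and whose strict transforms `Mst t p`
(`X_p^{m t} · Mst t p = β_p(M̄(T_{i t} := 1)(X + ā_t))`) avoid the bad primes of `gst t p` off `E' t p`. THEN there is a form `Φ ∈ O[T_σ]_d`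
with `π Φ = g`, CENTRED (`Φ(T_{i t} := 1) ∈ 𝔪_{a_t}^{m t}`), Δ-REGULAR OFF `E` on the standard charts, and with STRICT TRANSFORMS `Φst t p`
(`X_p^{m t} · Φst t p = β_p(Φ(T_{i t} := 1)(X + a_t))`, `π Φst t p = gst t p`) Δ-REGULAR OFF `E' t p`. One genericity constant `c` serves
all charts (part 8's `…_off_linear` with the strict-transform charts as extra `O`-linear chart maps). [cite: Matsumura1987, Thm. 14.2]
[OURS · L1 W4.5b] -/
theorem exists_isHomogeneous_clusterLift_deltaRegular_stCharts (hϖ : Irreducible ϖ) (π : O →+* k)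
    (hπ : Function.Surjective π) (hker : RingHom.ker π = Ideal.span {ϖ}) {d : ℕ}
    (i : ι → σ) (a : (t : ι) → {j : σ // j ≠ i t} → O) (m : ι → ℕ)
    (hind : ∀ v : (t : ι) → ({j : σ // j ≠ i t} →₀ ℕ) → k, ∃ g' : MvPolynomial σ k, g'.IsHomogeneous d ∧
      ∀ t α, α.degree < m t →
        coeff α (aeval (fun j => (X j : MvPolynomial {j : σ // j ≠ i t} k) + C (π (a t j))) (dehomogenize (i t) g'))
          = v t α)
    (g : MvPolynomial σ k) (hg : g.IsHomogeneous d)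
    (hgZ : ∀ t, dehomogenize (i t) g ∈
      (Ideal.span (Set.range fun j => (X j : MvPolynomial {j : σ // j ≠ i t} k) - C (π (a t j)))) ^ m t)
    -- standard charts
    (E : (j : σ) → Set (PrimeSpectrum (MvPolynomial {l : σ // l ≠ j} k)))
    (hfin : ∀ j : σ, {𝔮 : PrimeSpectrum (MvPolynomial {l : σ // l ≠ j} k) |
      dehomogenize j g ∈ 𝔮.asIdeal ∧
      algebraMap (MvPolynomial {l : σ // l ≠ j} k) (Localization.AtPrime 𝔮.asIdeal) (dehomogenize j g) ∈
        maximalIdeal (Localization.AtPrime 𝔮.asIdeal) ^ 2}.Finite)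
    -- strict-transform charts
    (gst : (t : ι) → {j : σ // j ≠ i t} → MvPolynomial {j : σ // j ≠ i t} k)
    (hgst : ∀ t p, (X p : MvPolynomial {j : σ // j ≠ i t} k) ^ m t * gst t p =
      aeval (fun j => if j = p then (X p : MvPolynomial {j : σ // j ≠ i t} k) else X p * X j)
        (aeval (fun l => (X l : MvPolynomial {j : σ // j ≠ i t} k) + C (π (a t l))) (dehomogenize (i t) g)))
    (E' : (t : ι) → {j : σ // j ≠ i t} → Set (PrimeSpectrum (MvPolynomial {j : σ // j ≠ i t} k)))
    (hfinst : ∀ t p, {𝔮 : PrimeSpectrum (MvPolynomial {j : σ // j ≠ i t} k) | gst t p ∈ 𝔮.asIdeal ∧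
      algebraMap (MvPolynomial {j : σ // j ≠ i t} k) (Localization.AtPrime 𝔮.asIdeal) (gst t p) ∈
        maximalIdeal (Localization.AtPrime 𝔮.asIdeal) ^ 2}.Finite)
    -- the witness
    (Mbar : MvPolynomial σ k) (hMbar : Mbar.IsHomogeneous d)
    (hMZ : ∀ t, dehomogenize (i t) Mbar ∈
      (Ideal.span (Set.range fun j => (X j : MvPolynomial {j : σ // j ≠ i t} k) - C (π (a t j)))) ^ m t)
    (hMavoid : ∀ (j : σ) (𝔮 : PrimeSpectrum (MvPolynomial {l : σ // l ≠ j} k)), 𝔮 ∉ E j →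
      dehomogenize j g ∈ 𝔮.asIdeal →
      algebraMap (MvPolynomial {l : σ // l ≠ j} k) (Localization.AtPrime 𝔮.asIdeal) (dehomogenize j g) ∈
        maximalIdeal (Localization.AtPrime 𝔮.asIdeal) ^ 2 →
      dehomogenize j Mbar ∉ 𝔮.asIdeal)
    (Mst : (t : ι) → {j : σ // j ≠ i t} → MvPolynomial {j : σ // j ≠ i t} k)
    (hMst : ∀ t p, (X p : MvPolynomial {j : σ // j ≠ i t} k) ^ m t * Mst t p =
      aeval (fun j => if j = p then (X p : MvPolynomial {j : σ // j ≠ i t} k) else X p * X j)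
        (aeval (fun l => (X l : MvPolynomial {j : σ // j ≠ i t} k) + C (π (a t l))) (dehomogenize (i t) Mbar)))
    (hMstavoid : ∀ t p (𝔮 : PrimeSpectrum (MvPolynomial {j : σ // j ≠ i t} k)), 𝔮 ∉ E' t p → gst t p ∈ 𝔮.asIdeal →
      algebraMap (MvPolynomial {j : σ // j ≠ i t} k) (Localization.AtPrime 𝔮.asIdeal) (gst t p) ∈
        maximalIdeal (Localization.AtPrime 𝔮.asIdeal) ^ 2 →
      Mst t p ∉ 𝔮.asIdeal) :
    ∃ Φ : MvPolynomial σ O, Φ.IsHomogeneous d ∧ MvPolynomial.map π Φ = g ∧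
      (∀ t, dehomogenize (i t) Φ ∈
        (Ideal.span (Set.range fun j => (X j : MvPolynomial {j : σ // j ≠ i t} O) - C (a t j))) ^ m t) ∧
      (∀ (j : σ) (Q : Ideal (MvPolynomial {l : σ // l ≠ j} O ⧸ Ideal.span {dehomogenize j Φ})) [Q.IsPrime],
        Ideal.Quotient.mk (Ideal.span {dehomogenize j Φ}) (C ϖ : MvPolynomial {l : σ // l ≠ j} O) ∈ Q →
        (∀ 𝔮 ∈ E j, 𝔮.asIdeal.comap (MvPolynomial.map (σ := {l : σ // l ≠ j}) π) ≠
          Q.comap (Ideal.Quotient.mk (Ideal.span {dehomogenize j Φ}))) →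
        IsRegularLocalRing (Localization.AtPrime Q)) ∧
      ∀ t (p : {j : σ // j ≠ i t}), ∃ Φst : MvPolynomial {j : σ // j ≠ i t} O,
        (X p : MvPolynomial {j : σ // j ≠ i t} O) ^ m t * Φst =
          aeval (fun j => if j = p then (X p : MvPolynomial {j : σ // j ≠ i t} O) else X p * X j)
            (aeval (fun l => (X l : MvPolynomial {j : σ // j ≠ i t} O) + C (a t l)) (dehomogenize (i t) Φ)) ∧
        MvPolynomial.map π Φst = gst t p ∧
        ∀ (Q : Ideal (MvPolynomial {j : σ // j ≠ i t} O ⧸ Ideal.span {Φst})) [Q.IsPrime],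
          Ideal.Quotient.mk (Ideal.span {Φst}) (C ϖ : MvPolynomial {j : σ // j ≠ i t} O) ∈ Q →
          (∀ 𝔮 ∈ E' t p, 𝔮.asIdeal.comap (MvPolynomial.map (σ := {j : σ // j ≠ i t}) π) ≠
            Q.comap (Ideal.Quotient.mk (Ideal.span {Φst}))) →
          IsRegularLocalRing (Localization.AtPrime Q) := by
  classical
  -- chart index: standard charts `j : σ` and strict-transform charts `(t, p)`
  let K := σ ⊕ (Σ t : ι, {j : σ // j ≠ i t})
  let τ : K → Type u := Sum.elim (fun j : σ => {l : σ // l ≠ j}) (fun tp : (Σ t : ι, {j : σ // j ≠ i t}) => {j : σ // j ≠ i tp.1})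
  haveI : ∀ κ, Finite (τ κ) := fun κ => by
    rcases κ with j | tp
    · exact (inferInstance : Finite {l : σ // l ≠ j})
    · exact (inferInstance : Finite {j : σ // j ≠ i tp.1})
  -- the blow-up chart `B_{a,p}` over `O` and over `k`, and the `O`-linear strict-transform chart maps
  have stO_add : ∀ (t : ι) (p : {j : σ // j ≠ i t}) (F G : MvPolynomial {j : σ // j ≠ i t} O),
      MvPolynomial.divMonomial (aeval (fun j => if j = p then (X p : MvPolynomial {j : σ // j ≠ i t} O) else X p * X j)
        (aeval (fun l => (X l : MvPolynomial {j : σ // j ≠ i t} O) + C (a t l)) (F + G))) (Finsupp.single p (m t)) =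
      MvPolynomial.divMonomial (aeval (fun j => if j = p then (X p : MvPolynomial {j : σ // j ≠ i t} O) else X p * X j)
        (aeval (fun l => (X l : MvPolynomial {j : σ // j ≠ i t} O) + C (a t l)) F)) (Finsupp.single p (m t)) +
      MvPolynomial.divMonomial (aeval (fun j => if j = p then (X p : MvPolynomial {j : σ // j ≠ i t} O) else X p * X j)
        (aeval (fun l => (X l : MvPolynomial {j : σ // j ≠ i t} O) + C (a t l)) G)) (Finsupp.single p (m t)) :=
    fun t p F G => by rw [map_add, map_add, add_divMonomial]
  let stO : (t : ι) → (p : {j : σ // j ≠ i t}) →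
      (MvPolynomial {j : σ // j ≠ i t} O →ₗ[O] MvPolynomial {j : σ // j ≠ i t} O) := fun t p =>
    { toFun := fun F => MvPolynomial.divMonomial
        (aeval (fun j => if j = p then (X p : MvPolynomial {j : σ // j ≠ i t} O) else X p * X j)
          (aeval (fun l => (X l : MvPolynomial {j : σ // j ≠ i t} O) + C (a t l)) F)) (Finsupp.single p (m t))
      map_add' := stO_add t p
      map_smul' := fun c F => by rw [map_smul, map_smul, smul_divMonomial, RingHom.id_apply] }
  let stk : (t : ι) → (p : {j : σ // j ≠ i t}) →
      (MvPolynomial {j : σ // j ≠ i t} k →ₗ[k] MvPolynomial {j : σ // j ≠ i t} k) := fun t p =>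
    { toFun := fun F => MvPolynomial.divMonomial
        (aeval (fun j => if j = p then (X p : MvPolynomial {j : σ // j ≠ i t} k) else X p * X j)
          (aeval (fun l => (X l : MvPolynomial {j : σ // j ≠ i t} k) + C (π (a t l))) F)) (Finsupp.single p (m t))
      map_add' := fun F G => by rw [map_add, map_add, add_divMonomial]
      map_smul' := fun c F => by rw [map_smul, map_smul, smul_divMonomial, RingHom.id_apply] }
  have hstO : ∀ t p F, stO t p F = MvPolynomial.divMonomial
      (aeval (fun j => if j = p then (X p : MvPolynomial {j : σ // j ≠ i t} O) else X p * X j)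
        (aeval (fun l => (X l : MvPolynomial {j : σ // j ≠ i t} O) + C (a t l)) F)) (Finsupp.single p (m t)) :=
    fun _ _ _ => rfl
  have hstk : ∀ t p F, stk t p F = MvPolynomial.divMonomial
      (aeval (fun j => if j = p then (X p : MvPolynomial {j : σ // j ≠ i t} k) else X p * X j)
        (aeval (fun l => (X l : MvPolynomial {j : σ // j ≠ i t} k) + C (π (a t l))) F)) (Finsupp.single p (m t)) :=
    fun _ _ _ => rfl
  let L : (κ : K) → MvPolynomial σ O →ₗ[O] MvPolynomial (τ κ) O := fun κ =>
    Sum.rec (motive := fun κ => MvPolynomial σ O →ₗ[O] MvPolynomial (τ κ) O)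
      (fun j => (dehomogenize j).toLinearMap) (fun tp => stO tp.1 tp.2 ∘ₗ (dehomogenize (i tp.1)).toLinearMap) κ
  let l : (κ : K) → MvPolynomial σ k →ₗ[k] MvPolynomial (τ κ) k := fun κ =>
    Sum.rec (motive := fun κ => MvPolynomial σ k →ₗ[k] MvPolynomial (τ κ) k)
      (fun j => (dehomogenize j).toLinearMap) (fun tp => stk tp.1 tp.2 ∘ₗ (dehomogenize (i tp.1)).toLinearMap) κ
  have hLinl : ∀ j F, L (Sum.inl j) F = dehomogenize j F := fun _ _ => rfl
  have hLinr : ∀ t p F, L (Sum.inr ⟨t, p⟩) F = stO t p (dehomogenize (i t) F) := fun _ _ _ => rfl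
  have hlinl : ∀ j F, l (Sum.inl j) F = dehomogenize j F := fun _ _ => rfl
  have hlinr : ∀ t p F, l (Sum.inr ⟨t, p⟩) F = stk t p (dehomogenize (i t) F) := fun _ _ _ => rfl
  have hLl : ∀ κ F, MvPolynomial.map π (L κ F) = l κ (MvPolynomial.map π F) := by
    rintro (j | ⟨t, p⟩) F
    · exact map_dehomogenize j π F
    · show MvPolynomial.map π (stO t p (dehomogenize (i t) F)) = stk t p (dehomogenize (i t) (MvPolynomial.map π F))
      rw [hstO, hstk, map_divMonomial, map_blowupSubst_shift, map_dehomogenize]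
  -- the downstairs strict transforms are the chart maps' values
  have hlg : ∀ t p, l (Sum.inr ⟨t, p⟩) g = gst t p := by
    intro t p
    rw [hlinr, hstk, ← hgst, X_pow_eq_monomial, divMonomial_monomial_mul]
  have hlM : ∀ t p, l (Sum.inr ⟨t, p⟩) Mbar = Mst t p := by
    intro t p
    rw [hlinr, hstk, ← hMst, X_pow_eq_monomial, divMonomial_monomial_mul]
  -- excluded sets in the chart-indexed form
  let EE : (κ : K) → Set (PrimeSpectrum (MvPolynomial (τ κ) k)) := fun κ =>
    Sum.rec (motive := fun κ => Set (PrimeSpectrum (MvPolynomial (τ κ) k))) (fun j => E j) (fun tp => E' tp.1 tp.2) κ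
  have hfinK : ∀ κ, {𝔮 : PrimeSpectrum (MvPolynomial (τ κ) k) | l κ g ∈ 𝔮.asIdeal ∧
      algebraMap (MvPolynomial (τ κ) k) (Localization.AtPrime 𝔮.asIdeal) (l κ g) ∈
        maximalIdeal (Localization.AtPrime 𝔮.asIdeal) ^ 2}.Finite := by
    rintro (j | ⟨t, p⟩)
    · exact hfin j
    · have h := hfinst t p
      rw [← hlg] at h
      exact h
  have havoidK : ∀ (κ : K) (𝔮 : PrimeSpectrum (MvPolynomial (τ κ) k)), 𝔮 ∉ EE κ → l κ g ∈ 𝔮.asIdeal →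
      algebraMap (MvPolynomial (τ κ) k) (Localization.AtPrime 𝔮.asIdeal) (l κ g) ∈
        maximalIdeal (Localization.AtPrime 𝔮.asIdeal) ^ 2 → l κ Mbar ∉ 𝔮.asIdeal := by
    rintro (j | ⟨t, p⟩) 𝔮 h𝔮E h1 h2
    · exact hMavoid j 𝔮 h𝔮E h1 h2
    · rw [hlg] at h1 h2
      rw [hlM]
      exact hMstavoid t p 𝔮 h𝔮E h1 h2
  obtain ⟨Φ, hΦ, hΦg, hΦZ, hreg⟩ := exists_isHomogeneous_clusterLift_deltaRegular_off_linear (K := K) (τ := τ) hϖ π hπ hker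
    i a m hind g hg hgZ L l hLl EE hfinK Mbar hMbar hMZ havoidK
  refine ⟨Φ, hΦ, hΦg, hΦZ, fun j => ?_, fun t p => ?_⟩
  · intro Q hQp hQ hQE
    exact @hreg (Sum.inl j) Q hQp hQ hQE
  · refine ⟨stO t p (dehomogenize (i t) Φ), ?_, ?_, ?_⟩
    · rw [hstO]
      exact X_pow_mul_divMonomial_eq_of_mem p (blowupSubst_shift_mem_span_X_pow p (a t) (hΦZ t))
    · have h1 : MvPolynomial.map π (stO t p (dehomogenize (i t) Φ)) = stk t p (dehomogenize (i t) (MvPolynomial.map π Φ)) :=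
        hLl (Sum.inr ⟨t, p⟩) Φ
      rw [h1, hΦg]
      exact hlg t p
    · intro Q hQp hQ hQE
      exact @hreg (Sum.inr ⟨t, p⟩) Q hQp hQ hQE

end Cone

end Summit.ResolutionOfSingularities.ResolutionOfSingularities.Cruxes.EquisingularLiftNat.Sections

end
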